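import Summits.AtomisticToContinuum.Crystallization.Theorems.FrustratedLawDichotomyAtlasReach
import Summits.AtomisticToContinuum.Crystallization.Theorems.FrustratedLawDichotomyZoneKernel

/-!
# FrustratedLawDichotomy · crux `AperiodicFrustratedLawGap` (stmt-AtomisticToContinuum-27623) — (404′) THE REACH THEOREM WITH TRANSPORT
# (decomp-a2c, RESIDUAL lens-5 «finite/base range + asymptotic regime + bridge», generation 118; node K1 of the g117 mechanism memo, critic r1906 (C))

(404) `…AtlasReach.coherentMassExclusion_of_floors` books certified row floors `e⋆ + m_i ≤ rootEnergy μ` (margins `≥ m > 0`) against a SITEWISE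
deficit cap `hcap : ∀ μ, IsRootedHardCore (7/10) μ → e⋆ − rootEnergy μ ≤ D` and proves F(η) «no admissible minimising law is `(1−η)`-coherent with the
atlas» for `η ≤ reach m D = m/(m+D)`; (410) `…AperiodicFrustratedLawGap.Negative.OffAtlasCapCeiling` then FLOORS every such `D` at `≥ 0.613` by one
177-point rooted `7/10`-hard-core cluster whose root is over-coordinated by 24 COMPRESSED neighbours (`rootEnergy ≤ −1.3995`): the sitewise dial is
closed at `η(F1) < 0.82 %`.  THIS FILE is the same bookkeeping over the tree's TRANSPORTED door (325) `…AtlasDoorTransport` / `…SignedLedger.net`: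
* §1–§2 ★★ `coherentMassExclusion_of_floorsT`: row floors ON THE TRANSPORTED ENERGY `rootEnergy μ + net F G μ`, jointly measurable kernels `F`, `G`
  with bounded out-flow on rooted `7/10`-hard-core configurations (the door clauses of (325), by name), and the TRANSPORTED CAP SLOT
  `hcapT : ∀ μ, IsRootedHardCore (7/10) μ → e⋆ − rootEnergy μ − net F G μ ≤ D` prove `CoherentMassExclusion n K η` for every `η ≤ reach m D` — the
  reach formula is UNCHANGED, only the cap is re-read; ★★ `aperiodicFrustratedLawGap_of_offAtlasMassGapT`: crux ⟸ these lines ∧ A(η) ((404)'s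
  `OffAtlasMassGap`, the residual of record, UNCHANGED).  Law level: `residual_le_capT`, `residual_lt_credit_of_massT` (mean of `net` is `0` a.s.,
  `…SignedLedger.integral_net_eq_zero`; the law-ledger inequality is (325) `lt_integral_rootEnergy_of_rowsTransport`).  Sanity `…_zero`: `F = G = 0` is (404).
* §3 `capT_of_markSplit`: for the tree's pull kernels `(0, pullKernel Hm R w)` of a covariant mark ((329) `…PullKernel`) the cap slot splits into a
  MARKED-root reading `e⋆ − rootEnergy − out ≤ D` (income lowers the deficit) and an UNMARKED-root reading `e⋆ − rootEnergy + in ≤ D`.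
* §4 THE COMPRESSION MARK `Uncompressed r₁ := HostLikeAt (7/10) 0 {(∅, ball 0 r₁ ∖ {0})}` — the tree's host-like mark ((334′) `…ZoneKernel`) with the
  ONE-ENTRY atlas «empty pattern, punctured-ball window»: re-rooted at `y`, no atom within `(0, r₁)` of `y` — so covariance (`hostLikeAt_hshift`) and
  JOINT MEASURABILITY (`measurableSet_hostLikeAt`) are inherited, not re-proved; the COMPRESSION PULL `compPull r₁ R a := pullKernel (Uncompressed r₁) R a`:
  an uncompressed root pulls `a` from every compressed atom within `R`; door clauses `measurable_compPull`, `exists_outflow_bound_compPull` by name.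
* §5 ★ THE NON-TRANSFER MECHANISM (typed, generic): at a rooted hard-core configuration whose root is uncompressed, every finite set `T` of compressed
  atoms within `R` pays: `|T|·a ≤ net 0 (compPull r₁ R a) μ` (`card_mul_le_net_compPull`), so the transported deficit is `≤ e⋆ − rootEnergy μ − |T|·a`
  (`transportedDeficit_le_of_contacts`).  The companion `…AperiodicFrustratedLawGap.Negative.OffAtlasCapCeilingTransport` instantiates this at the
  (410) witness (`r₁ = 4/5`, `R = 11/10`, `|T| = 24`): its transported deficit is `≤ 0` for `a ≥ 3/100`, i.e. (410)'s proof of the `0.613` floor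
  (`hcap _ isRootedHardCore_cluster`) yields NOTHING against `hcapT` — the g117 ceiling does not transfer verbatim.
HONEST LABELS.  F_T(η) := the conclusion of `coherentMassExclusion_of_floorsT` is (404)'s F(η) — WEAKER than the crux, PROVED here modulo (i) transported
row floors [ATTACKABLE: at a marked root every (228) floor transports verbatim, (329) `floor_add_net_of_floor`; here `floorT_of_floor_uncompressed`] and
(ii) a transported cap certificate `D_T` [INSTRUMENTABLE, K2 of the memo, kit-sized, NOT in this file]; A(η) [residual, IDEA-NEEDED] is untouched.
This file proves NO numeric `D_T` and claims no reach figure; it certifies that the slot exists in the tree's own names, that the reach dial reads it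
unchanged, and (with the companion) that the one obstruction known to close the sitewise dial is booked away by the simplest admissible kernel.
Imports: TREE (404) `…AtlasReach`, (334′) `…ZoneKernel` (hence (325) `…AtlasDoorTransport`, (329) `…PullKernel`, `…CoherentOn`, `…SignedLedger`) only.
3 plain `def`s (`voidShell`, `Uncompressed` = a `HostLikeAt` instance, `compPull` = a `pullKernel` instance); no instance / notation / option; 0 sorry.
-/

noncomputable section

namespace Summit.AtomisticToContinuum.Crystallization.Theorems.FrustratedLawDichotomyAtlasReachTransport

open MeasureTheory Metric Set Filter
open scoped ENNReal BigOperators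
open Literature.MathematicalPhysics.StatisticalMechanics Literature.Probability.Process
open Summit.AtomisticToContinuum.Crystallization.Theorems.ChargedEnergyGapNegative (E3 eStar)
open Summit.AtomisticToContinuum.Crystallization.Theorems.FrustratedLawDichotomyMarginLedger (net_zero rowCell)
open Summit.AtomisticToContinuum.Crystallization.Theorems.FrustratedLawDichotomyFiniteClusterGap (integrable_rootEnergy_of_ae_hardCore)
open Summit.AtomisticToContinuum.Crystallization.Theorems.FrustratedLawDichotomySignedLedger (net integral_net_eq_zero)
open Summit.AtomisticToContinuum.Crystallization.Theorems.FrustratedLawDichotomyAtlasDoorTransport (lt_integral_rootEnergy_of_rowsTransport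
  lintegral_outflow_ne_top_of_bdd)
open Summit.AtomisticToContinuum.Crystallization.Theorems.FrustratedLawDichotomyAtlasReach (reach mul_measureReal_le_credit CoherentMassExclusion
  OffAtlasMassGap aperiodicFrustratedLawGap_of_massSplit coherentMassExclusion_of_floors)
open Summit.AtomisticToContinuum.Crystallization.Theorems.FrustratedLawDichotomyPullKernel
open Summit.AtomisticToContinuum.Crystallization.Theorems.FrustratedLawDichotomyCoherentOn (coherentOn mem_coherentOn_iff)
open Summit.AtomisticToContinuum.Crystallization.Theorems.FrustratedLawDichotomyZoneKernel (HostLikeAt hostLikeAt_hshift hostLikeAt_zero_iff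
  measurableSet_hostLikeAt)

variable {δ : ℝ} {P : Measure (Measure E3)} {n : ℕ} {K : ℕ → Set (Measure E3)} {mK : ℕ → ℝ} {F G : Measure E3 → E3 → ℝ≥0∞}

/-! ## §1. Law level: the transported residual against a transported cap -/

/-- residual side, transported: an a.s. cap `c − rootEnergy − net F G ≤ D` bounds the mean TRANSPORTED deficit of the uncovered roots by `D · P(U)`
(integrability of `net` from `…SignedLedger.integral_net_eq_zero`). [new: bookkeeping] -/
theorem residual_le_capT [IsProbabilityMeasure P] (hδ : 0 < δ) (hcore : ∀ᵐ μ ∂P, IsRootedHardCore δ μ) (hstat : IsPointStationaryLaw P)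
    (hF : Measurable (Function.uncurry F)) (hG : Measurable (Function.uncurry G)) (houtF : ∫⁻ μ, ∫⁻ y, F μ y ∂μ ∂P ≠ ∞)
    (houtG : ∫⁻ μ, ∫⁻ y, G μ y ∂μ ∂P ≠ ∞) {c D : ℝ} (hcapT : ∀ᵐ μ ∂P, c - rootEnergy lennardJones μ - net F G μ ≤ D) :
    ∫ μ in (⋃ i ∈ Finset.range n, K i)ᶜ, (c - rootEnergy lennardJones μ - net F G μ) ∂P ≤ D * P.real (⋃ i ∈ Finset.range n, K i)ᶜ := by
  have hI : Integrable (fun μ => c - rootEnergy lennardJones μ - net F G μ) P :=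
    ((integrable_const c).sub (integrable_rootEnergy_of_ae_hardCore hδ hcore)).sub (integral_net_eq_zero hδ hcore hstat hF hG houtF houtG).1
  calc ∫ μ in (⋃ i ∈ Finset.range n, K i)ᶜ, (c - rootEnergy lennardJones μ - net F G μ) ∂P ≤ ∫ _μ in (⋃ i ∈ Finset.range n, K i)ᶜ, D ∂P :=
        setIntegral_mono_ae hI.integrableOn (integrable_const D).integrableOn hcapT
    _ = D * P.real (⋃ i ∈ Finset.range n, K i)ᶜ := by rw [setIntegral_const, smul_eq_mul, mul_comm]

/-- ★ THE LAW-LEVEL REACH LEMMA WITH TRANSPORT: margins `≥ m > 0`, an a.s. transported cap `≤ D` and `P(U) < reach m D` give the transported residual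
inequality of (325) `lawLedgerOfRowsTransport`. [new: bookkeeping] -/
theorem residual_lt_credit_of_massT [IsProbabilityMeasure P] (hK : ∀ i, MeasurableSet (K i)) (hδ : 0 < δ) (hcore : ∀ᵐ μ ∂P, IsRootedHardCore δ μ)
    (hstat : IsPointStationaryLaw P) (hF : Measurable (Function.uncurry F)) (hG : Measurable (Function.uncurry G))
    (houtF : ∫⁻ μ, ∫⁻ y, F μ y ∂μ ∂P ≠ ∞) (houtG : ∫⁻ μ, ∫⁻ y, G μ y ∂μ ∂P ≠ ∞) {c m D : ℝ} (hm0 : 0 < m) (hD : 0 ≤ D) (hm : ∀ i < n, m ≤ mK i)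
    (hcapT : ∀ᵐ μ ∂P, c - rootEnergy lennardJones μ - net F G μ ≤ D) (hmass : P.real (⋃ i ∈ Finset.range n, K i)ᶜ < reach m D) :
    ∫ μ in (⋃ i ∈ Finset.range n, K i)ᶜ, (c - rootEnergy lennardJones μ - net F G μ) ∂P < ∑ i ∈ Finset.range n, mK i * P.real (rowCell K i) := by
  have hU : MeasurableSet (⋃ i ∈ Finset.range n, K i) := Finset.measurableSet_biUnion _ fun j _ => hK j
  have hcompl : P.real (⋃ i ∈ Finset.range n, K i)ᶜ = 1 - P.real (⋃ i ∈ Finset.range n, K i) := probReal_compl_eq_one_sub hU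
  have hmD : 0 < m + D := by linarith
  have h1 : P.real (⋃ i ∈ Finset.range n, K i)ᶜ * (m + D) < m := by
    have := hmass
    unfold reach at this
    rwa [lt_div_iff₀ hmD] at this
  have h2 : D * P.real (⋃ i ∈ Finset.range n, K i)ᶜ < m * P.real (⋃ i ∈ Finset.range n, K i) := by
    have h3 : m * P.real (⋃ i ∈ Finset.range n, K i) = m - m * P.real (⋃ i ∈ Finset.range n, K i)ᶜ := by rw [hcompl]; ring
    rw [h3]
    nlinarith
  exact lt_of_le_of_lt (residual_le_capT hδ hcore hstat hF hG houtF houtG hcapT) (lt_of_lt_of_le h2 (mul_measureReal_le_credit hK hm))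

/-- ★ COROLLARY (any level `c`, any hard core): a.s. transported row floors with margins `≥ m > 0`, an a.s. transported cap and `P(U) < reach m D`
price the mean root energy of a point-stationary hard-core law strictly above `c` ((325) `lt_integral_rootEnergy_of_rowsTransport`). [new: bookkeeping] -/
theorem lt_integral_rootEnergy_of_massT [IsProbabilityMeasure P] (hK : ∀ i, MeasurableSet (K i)) (hδ : 0 < δ) (hcore : ∀ᵐ μ ∂P, IsRootedHardCore δ μ)
    (hstat : IsPointStationaryLaw P) (hF : Measurable (Function.uncurry F)) (hG : Measurable (Function.uncurry G))
    (houtF : ∫⁻ μ, ∫⁻ y, F μ y ∂μ ∂P ≠ ∞) (houtG : ∫⁻ μ, ∫⁻ y, G μ y ∂μ ∂P ≠ ∞) {c m D : ℝ} (hm0 : 0 < m) (hD : 0 ≤ D) (hm : ∀ i < n, m ≤ mK i)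
    (hfloor : ∀ i < n, ∀ᵐ μ ∂P, μ ∈ K i → c + mK i ≤ rootEnergy lennardJones μ + net F G μ)
    (hcapT : ∀ᵐ μ ∂P, c - rootEnergy lennardJones μ - net F G μ ≤ D) (hmass : P.real (⋃ i ∈ Finset.range n, K i)ᶜ < reach m D) :
    c < ∫ μ, rootEnergy lennardJones μ ∂P :=
  lt_integral_rootEnergy_of_rowsTransport hδ hcore hstat hF hG houtF houtG n K hK mK hfloor
    (residual_lt_credit_of_massT hK hδ hcore hstat hF hG houtF houtG hm0 hD hm hcapT hmass)

/-! ## §2. ★★ The reach theorem with transport: transported floors + a transported cap prove F(reach) -/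

/-- ★★ **THE REACH THEOREM WITH TRANSPORT.**  Jointly measurable kernels `F`, `G` with out-flows bounded by finite constants on rooted `7/10`-hard-core
configurations (the door clauses of (325), by name), deterministic row floors ON THE TRANSPORTED ENERGY `rootEnergy μ + net F G μ` at every rooted
`7/10`-hard-core Nash configuration of each row (margins `m_i ≥ m > 0`), and a deterministic TRANSPORTED DEFICIT CAP `e⋆ − rootEnergy μ − net F G μ ≤ D`
on rooted `7/10`-hard-core configurations prove F(η) for every `η ≤ reach m D`. [new: junction] -/
theorem coherentMassExclusion_of_floorsT (n : ℕ) (K : ℕ → Set (MeasureTheory.Measure (EuclideanSpace ℝ (Fin 3)))) (hK : ∀ i, MeasurableSet (K i))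
    (mK : ℕ → ℝ) (F G : Measure E3 → E3 → ℝ≥0∞) (hF : Measurable (Function.uncurry F)) (hG : Measurable (Function.uncurry G)) {BF BG : ℝ≥0∞}
    (hBF : BF ≠ ∞) (hBG : BG ≠ ∞) (hFb : ∀ μ : Measure E3, IsRootedHardCore (7 / 10) μ → ∫⁻ y, F μ y ∂μ ≤ BF)
    (hGb : ∀ μ : Measure E3, IsRootedHardCore (7 / 10) μ → ∫⁻ y, G μ y ∂μ ≤ BG)
    (hfloorT : ∀ i < n, ∀ μ : Measure E3, IsRootedHardCore (7 / 10) μ →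
      (∀ p : E3, μ {p} ≠ 0 → ∀ y : E3, (∀ q : E3, μ {q} ≠ 0 → q ≠ p → y ≠ q) →
        ∑' q : {q : E3 // μ {q} ≠ 0 ∧ q ≠ p}, lennardJones (dist p (q : E3)) ≤ ∑' q : {q : E3 // μ {q} ≠ 0 ∧ q ≠ p}, lennardJones (dist y (q : E3))) →
      μ ∈ K i → eStar + mK i ≤ rootEnergy lennardJones μ + net F G μ)
    {m D : ℝ} (hm0 : 0 < m) (hD : 0 ≤ D) (hm : ∀ i < n, m ≤ mK i)
    (hcapT : ∀ μ : Measure E3, IsRootedHardCore (7 / 10) μ → eStar - rootEnergy lennardJones μ - net F G μ ≤ D) {η : ℝ} (hη : η ≤ reach m D) :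
    CoherentMassExclusion n K η := by
  intro P
  dsimp only
  intro hP ha hb hd he h0 hmin hmass
  have h7 : (0 : ℝ) < 7 / 10 := by norm_num
  have hfl : ∀ i < n, ∀ᵐ μ ∂P, μ ∈ K i → eStar + mK i ≤ rootEnergy lennardJones μ + net F G μ := fun i hi => by
    filter_upwards [ha, he] with μ hμ hN hμi using hfloorT i hi μ hμ hN hμi
  have hlt : eStar < ∫ μ, rootEnergy lennardJones μ ∂P :=
    lt_integral_rootEnergy_of_massT hK h7 ha hb hF hG (lintegral_outflow_ne_top_of_bdd ha hBF hFb) (lintegral_outflow_ne_top_of_bdd ha hBG hGb)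
      hm0 hD hm hfl (ha.mono fun μ hμ => hcapT μ hμ) (lt_of_lt_of_le hmass hη)
  exact absurd hmin (not_le.2 hlt)

/-- ★★ **JUNCTION TO THE CRUX (the mass split of (404), by name):** transported floors, a transported cap, and the residual A(η) = `OffAtlasMassGap n K η`
at `η = reach m D` (or below) prove `AperiodicFrustratedLawGap`. [new: junction] -/
theorem aperiodicFrustratedLawGap_of_offAtlasMassGapT (n : ℕ) (K : ℕ → Set (MeasureTheory.Measure (EuclideanSpace ℝ (Fin 3))))
    (hK : ∀ i, MeasurableSet (K i)) (mK : ℕ → ℝ) (F G : Measure E3 → E3 → ℝ≥0∞) (hF : Measurable (Function.uncurry F))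
    (hG : Measurable (Function.uncurry G)) {BF BG : ℝ≥0∞} (hBF : BF ≠ ∞) (hBG : BG ≠ ∞)
    (hFb : ∀ μ : Measure E3, IsRootedHardCore (7 / 10) μ → ∫⁻ y, F μ y ∂μ ≤ BF) (hGb : ∀ μ : Measure E3, IsRootedHardCore (7 / 10) μ → ∫⁻ y, G μ y ∂μ ≤ BG)
    (hfloorT : ∀ i < n, ∀ μ : Measure E3, IsRootedHardCore (7 / 10) μ →
      (∀ p : E3, μ {p} ≠ 0 → ∀ y : E3, (∀ q : E3, μ {q} ≠ 0 → q ≠ p → y ≠ q) →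
        ∑' q : {q : E3 // μ {q} ≠ 0 ∧ q ≠ p}, lennardJones (dist p (q : E3)) ≤ ∑' q : {q : E3 // μ {q} ≠ 0 ∧ q ≠ p}, lennardJones (dist y (q : E3))) →
      μ ∈ K i → eStar + mK i ≤ rootEnergy lennardJones μ + net F G μ)
    {m D : ℝ} (hm0 : 0 < m) (hD : 0 ≤ D) (hm : ∀ i < n, m ≤ mK i)
    (hcapT : ∀ μ : Measure E3, IsRootedHardCore (7 / 10) μ → eStar - rootEnergy lennardJones μ - net F G μ ≤ D) {η : ℝ} (hη : η ≤ reach m D)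
    (hA : OffAtlasMassGap n K η) : Summit.AtomisticToContinuum.Crystallization.Theses.FrustratedLawDichotomy.AperiodicFrustratedLawGap :=
  aperiodicFrustratedLawGap_of_massSplit n K η (coherentMassExclusion_of_floorsT n K hK mK F G hF hG hBF hBG hFb hGb hfloorT hm0 hD hm hcapT hη) hA

/-- Sanity: with ZERO transport (`F = G = 0`, `net 0 0 = 0`) the transported reach theorem is (404) `coherentMassExclusion_of_floors` — same floors,
same cap, same reach. [new: bookkeeping] -/
theorem coherentMassExclusion_of_floorsT_zero (n : ℕ) (K : ℕ → Set (MeasureTheory.Measure (EuclideanSpace ℝ (Fin 3)))) (hK : ∀ i, MeasurableSet (K i))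
    (mK : ℕ → ℝ)
    (hfloor : ∀ i < n, ∀ μ : Measure E3, IsRootedHardCore (7 / 10) μ →
      (∀ p : E3, μ {p} ≠ 0 → ∀ y : E3, (∀ q : E3, μ {q} ≠ 0 → q ≠ p → y ≠ q) →
        ∑' q : {q : E3 // μ {q} ≠ 0 ∧ q ≠ p}, lennardJones (dist p (q : E3)) ≤ ∑' q : {q : E3 // μ {q} ≠ 0 ∧ q ≠ p}, lennardJones (dist y (q : E3))) →
      μ ∈ K i → eStar + mK i ≤ rootEnergy lennardJones μ)
    {m D : ℝ} (hm0 : 0 < m) (hD : 0 ≤ D) (hm : ∀ i < n, m ≤ mK i)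
    (hcap : ∀ μ : Measure E3, IsRootedHardCore (7 / 10) μ → eStar - rootEnergy lennardJones μ ≤ D) {η : ℝ} (hη : η ≤ reach m D) :
    CoherentMassExclusion n K η :=
  coherentMassExclusion_of_floorsT n K hK mK (fun _ _ => 0) (fun _ _ => 0) measurable_const measurable_const ENNReal.zero_ne_top ENNReal.zero_ne_top
    (fun μ _ => by simp) (fun μ _ => by simp) (fun i hi μ hμ hN hμi => by rw [net_zero, add_zero]; exact hfloor i hi μ hμ hN hμi) hm0 hD hm
    (fun μ hμ => by rw [net_zero, sub_zero]; exact hcap μ hμ) hη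

/-! ## §3. The cap slot for pull kernels: marked roots earn, unmarked roots pay -/

/-- ★ For the pull transport `(0, pullKernel Hm R w)` of a covariant mark the transported cap slot SPLITS: at a MARKED root it reads
`c − rootEnergy μ − out_G(μ) ≤ D` (the income is booked against the deficit), at an UNMARKED root `c − rootEnergy μ + in_G(μ) ≤ D`
((329) `net_zero_pullKernel_of_mark` / `_of_not_mark`). [new: bookkeeping] -/
theorem capT_of_markSplit {Hm : Measure E3 → E3 → Prop} {R : ℝ} {w : E3 → ℝ≥0∞}
    (hshift : ∀ (μ : Measure E3) (y z : E3), Hm (μ.map fun x => x - y) z ↔ Hm μ (z + y)) {c D : ℝ}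
    (hmark : ∀ μ : Measure E3, IsRootedHardCore δ μ → Hm μ 0 → c - rootEnergy lennardJones μ - (∫⁻ y, pullKernel Hm R w μ y ∂μ).toReal ≤ D)
    (hunmk : ∀ μ : Measure E3, IsRootedHardCore δ μ → ¬ Hm μ 0 →
      c - rootEnergy lennardJones μ + (∫⁻ y, pullKernel Hm R w (μ.map fun x => x - y) (-y) ∂μ).toReal ≤ D) :
    ∀ μ : Measure E3, IsRootedHardCore δ μ → c - rootEnergy lennardJones μ - net 0 (pullKernel Hm R w) μ ≤ D := fun μ hμ => by
  by_cases h0 : Hm μ 0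
  · rw [net_zero_pullKernel_of_mark hshift h0]; exact hmark μ hμ h0
  · rw [net_zero_pullKernel_of_not_mark h0, sub_neg_eq_add]; exact hunmk μ hμ h0

/-! ## §4. The compression mark (a one-entry host-like atlas) and the compression pull -/

/-- The VOID WINDOW of radius `r₁`: the open ball about the root with the root removed. [new: dial] -/
def voidShell (r₁ : ℝ) : Set E3 := ball 0 r₁ \ {0}

/-- The void window is measurable. [folklore] -/
theorem measurableSet_voidShell (r₁ : ℝ) : MeasurableSet (voidShell r₁) := measurableSet_ball.diff (measurableSet_singleton 0)

/-- ★ **THE COMPRESSION MARK** `Uncompressed r₁ μ y`: re-rooted at `y`, `μ` is rooted `7/10`-hard-core and carries no atom within `(0, r₁)` of `y`.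
LITERALLY the tree's host-like mark with the one-entry atlas `{(∅, voidShell r₁)}` (empty pattern, punctured-ball window, tolerance `0`). [new: dial] -/
def Uncompressed (r₁ : ℝ) : Measure E3 → E3 → Prop := HostLikeAt (7 / 10) 0 {((∅ : Finset E3), voidShell r₁)}

/-- Exact covariance of the compression mark (the `hshift` of (329)), inherited from `hostLikeAt_hshift`. [folklore] -/
theorem uncompressed_hshift (r₁ : ℝ) : ∀ (μ : Measure E3) (y z : E3), Uncompressed r₁ (μ.map fun x => x - y) z ↔ Uncompressed r₁ μ (z + y) :=
  hostLikeAt_hshift (7 / 10) 0 _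

/-- ★ Joint measurability of the compression mark (the `hmeas` of (329)), inherited from `measurableSet_hostLikeAt`. [folklore] -/
theorem measurableSet_uncompressed (r₁ : ℝ) : MeasurableSet {p : Measure E3 × E3 | Uncompressed r₁ p.1 p.2} :=
  measurableSet_hostLikeAt (by norm_num) (Set.countable_singleton _) fun p hp => by
    rw [Set.mem_singleton_iff] at hp
    rw [hp]
    exact measurableSet_voidShell r₁

/-- Coherence with the EMPTY pattern on a window is emptiness of the window. [folklore] -/
theorem mem_coherentOn_empty (τ : ℝ) (W₀ : Set E3) (ν : Measure E3) : ν ∈ coherentOn ∅ τ W₀ ↔ ν W₀ = 0 := by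
  simp [mem_coherentOn_iff]

/-- The compression mark AT THE ROOT: hard core plus an empty void window. [folklore] -/
theorem uncompressed_zero_iff (r₁ : ℝ) (μ : Measure E3) : Uncompressed r₁ μ 0 ↔ IsRootedHardCore (7 / 10) μ ∧ μ (voidShell r₁) = 0 := by
  unfold Uncompressed
  rw [hostLikeAt_zero_iff]
  refine and_congr Iff.rfl ?_
  simp only [Set.mem_singleton_iff, exists_eq_left]
  exact mem_coherentOn_empty 0 (voidShell r₁) μ

/-- ★ A CONTACT UNMARKS: an atom `z ≠ y` of `μ` at distance `< r₁` from `y` makes `y` compressed. [folklore] -/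
theorem not_uncompressed_of_contact {r₁ : ℝ} {μ : Measure E3} {y z : E3} (hz : μ {z} ≠ 0) (hzy : z ≠ y) (hd : dist z y < r₁) :
    ¬ Uncompressed r₁ μ y := by
  rintro ⟨-, p, hp, hcoh⟩
  rw [Set.mem_singleton_iff] at hp
  rw [hp] at hcoh
  have h0 : (μ.map fun x => x - y) (voidShell r₁) = 0 := (mem_coherentOn_empty 0 (voidShell r₁) _).1 hcoh
  rw [Measure.map_apply (measurable_sub_const y) (measurableSet_voidShell r₁)] at h0
  have hzmem : z ∈ (fun x => x - y) ⁻¹' voidShell r₁ := by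
    refine ⟨mem_ball_zero_iff.2 (by rwa [← dist_eq_norm]), fun h => hzy ?_⟩
    exact sub_eq_zero.1 (Set.mem_singleton_iff.1 h)
  exact hz (measure_mono_null (Set.singleton_subset_iff.2 hzmem) h0)

/-- ★ **THE COMPRESSION PULL** `compPull r₁ R a`: an uncompressed root pulls the constant `a ≥ 0` from every compressed atom within `R` — the tree's
cell-free pull kernel of the compression mark with constant weight. [new: dial] -/
def compPull (r₁ R a : ℝ) : Measure E3 → E3 → ℝ≥0∞ := pullKernel (Uncompressed r₁) R fun _ => ENNReal.ofReal a

/-- Door clause `hG` of (325): the compression pull is jointly measurable ((329) `measurable_pullKernel`). [folklore] -/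
theorem measurable_compPull (r₁ R a : ℝ) : Measurable (Function.uncurry (compPull r₁ R a)) :=
  measurable_pullKernel (measurableSet_uncompressed r₁) measurable_const

/-- Door clauses `hBG`, `hGb` of (325): uniformly bounded out-flow on rooted `7/10`-hard-core configurations ((329) `exists_outflow_bound_pullKernel`).
[folklore] -/
theorem exists_outflow_bound_compPull (r₁ R a : ℝ) :
    ∃ B : ℝ≥0∞, B ≠ ∞ ∧ ∀ μ : Measure E3, IsRootedHardCore (7 / 10) μ → ∫⁻ y, compPull r₁ R a μ y ∂μ ≤ B :=
  exists_outflow_bound_pullKernel (by norm_num) _ R ENNReal.ofReal_ne_top fun _ => le_rfl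

/-- Transported floors at UNCOMPRESSED roots come for free from sitewise floors ((329) `floor_add_net_of_floor`): the `hfloorT` lines of §2 for every
row whose members have an uncompressed root are the (228) `hfloor` lines verbatim. [folklore] -/
theorem floorT_of_floor_uncompressed {r₁ R a : ℝ} {μ : Measure E3} (h0 : Uncompressed r₁ μ 0) {c m : ℝ} (h : c + m ≤ rootEnergy lennardJones μ) :
    c + m ≤ rootEnergy lennardJones μ + net 0 (compPull r₁ R a) μ :=
  floor_add_net_of_floor (uncompressed_hshift r₁) h0 h

/-! ## §5. ★ The non-transfer mechanism: compressed neighbours pay the root -/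

/-- Atoms of a rooted hard-core configuration have unit mass. [folklore] -/
theorem apply_singleton_eq_one {μ : Measure E3} (hμ : IsRootedHardCore δ μ) {y : E3} (hy : μ {y} ≠ 0) : μ {y} = 1 := by
  obtain ⟨S, -, -, rfl⟩ := hμ
  have hyS : y ∈ S := (count_restrict_singleton_ne_zero_iff S y).1 hy
  rw [Measure.restrict_apply (measurableSet_singleton y), Set.inter_eq_left.2 (Set.singleton_subset_iff.2 hyS), Measure.count_singleton]

/-- A finite sum over atoms is below the integral. [folklore] -/
theorem sum_le_lintegral_of_atoms {μ : Measure E3} (hμ : IsRootedHardCore δ μ) (T : Finset E3) (hT : ∀ y ∈ T, μ {y} ≠ 0) (g : E3 → ℝ≥0∞) :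
    ∑ y ∈ T, g y ≤ ∫⁻ y, g y ∂μ :=
  calc ∑ y ∈ T, g y = ∑ y ∈ T, g y * μ {y} := Finset.sum_congr rfl fun y hy => by rw [apply_singleton_eq_one hμ (hT y hy), mul_one]
    _ = ∫⁻ y in ↑T, g y ∂μ := (lintegral_finset T g).symm
    _ ≤ ∫⁻ y, g y ∂μ := lintegral_mono' Measure.restrict_le_self le_rfl

/-- At an uncompressed root the net flow of the compression pull is its out-flow (nobody pulls from an uncompressed root, by covariance). [folklore] -/
theorem net_compPull_of_root {r₁ R a : ℝ} {μ : Measure E3} (h0 : Uncompressed r₁ μ 0) :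
    net 0 (compPull r₁ R a) μ = (∫⁻ y, compPull r₁ R a μ y ∂μ).toReal :=
  net_zero_pullKernel_of_mark (uncompressed_hshift r₁) h0

/-- ★ **COMPRESSED NEIGHBOURS PAY THE ROOT.**  At a rooted `7/10`-hard-core configuration with uncompressed root, every finite set `T` of compressed
atoms within `R` contributes `|T|·a` to the root's net income under the compression pull. [new: mechanism] -/
theorem card_mul_le_net_compPull {r₁ R a : ℝ} (ha : 0 ≤ a) {μ : Measure E3} (hμ : IsRootedHardCore (7 / 10) μ) (h0 : Uncompressed r₁ μ 0)
    (T : Finset E3) (hT : ∀ y ∈ T, μ {y} ≠ 0 ∧ ‖y‖ ≤ R ∧ ¬ Uncompressed r₁ μ y) : (T.card : ℝ) * a ≤ net 0 (compPull r₁ R a) μ := by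
  obtain ⟨B, hB, hBb⟩ := exists_outflow_bound_compPull r₁ R a
  have hsum : ∑ y ∈ T, compPull r₁ R a μ y = (T.card : ℝ≥0∞) * ENNReal.ofReal a :=
    calc ∑ y ∈ T, compPull r₁ R a μ y = ∑ _y ∈ T, ENNReal.ofReal a :=
          Finset.sum_congr rfl fun y hy => pullKernel_of_mem h0 (hT y hy).2.1 (hT y hy).2.2
      _ = (T.card : ℝ≥0∞) * ENNReal.ofReal a := by rw [Finset.sum_const, nsmul_eq_mul]
  have hle : (T.card : ℝ≥0∞) * ENNReal.ofReal a ≤ ∫⁻ y, compPull r₁ R a μ y ∂μ := hsum ▸ sum_le_lintegral_of_atoms hμ T (fun y hy => (hT y hy).1) _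
  have h := ENNReal.toReal_mono (ne_top_of_le_ne_top hB (hBb μ hμ)) hle
  rw [ENNReal.toReal_mul, ENNReal.toReal_natCast, ENNReal.toReal_ofReal ha] at h
  rwa [net_compPull_of_root h0]

/-- ★ **THE TRANSPORTED DEFICIT AT AN OVER-COORDINATED-BY-COMPRESSION ROOT**: `c − rootEnergy μ − net ≤ c − rootEnergy μ − |T|·a`.  The mechanism by
which the (410) witness — 24 compressed neighbours within `11/10` of an uncompressed root — stops flooring the cap once the cap is transported
(companion `…Negative.OffAtlasCapCeilingTransport`). [new: mechanism] -/
theorem transportedDeficit_le_of_contacts {r₁ R a : ℝ} (ha : 0 ≤ a) {μ : Measure E3} (hμ : IsRootedHardCore (7 / 10) μ) (h0 : Uncompressed r₁ μ 0)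
    (T : Finset E3) (hT : ∀ y ∈ T, μ {y} ≠ 0 ∧ ‖y‖ ≤ R ∧ ¬ Uncompressed r₁ μ y) (c : ℝ) :
    c - rootEnergy lennardJones μ - net 0 (compPull r₁ R a) μ ≤ c - rootEnergy lennardJones μ - T.card * a := by
  linarith [card_mul_le_net_compPull ha hμ h0 T hT]

end Summit.AtomisticToContinuum.Crystallization.Theorems.FrustratedLawDichotomyAtlasReachTransport
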